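import Summits.Ventures.GridStability.Bench.WSCC9SP9SlabRate
import Summits.Ventures.GridStability.Bench.WSCC9SP9SlabORate
import Literature.MathematicalPhysics.PowerSystems.LuriePostnikovSlabInnerBall

/-!
# GridStability/Bench/WSCC9SP9SlabBall — «#45-BALL» / «#94′-BALL»: CERTIFIED Euclidean inner balls of the SP9 slab wells
# (★ #45's certificate and the rate-optimised lineage O), one application of lit-6's `ball_subset_well` BY NAME each

Cell `gridfusion` (LADDER-GRIDFUSION), SP–Lur'e lane; seat gridfusion-model-2 (g7, row owner of the SP9 slab rows); lead g7 RULING 8g (5):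
«per-row «BALL» upgrades (VALIDATED radius → CERTIFIED inner ball by an instance-level decide) … an upgrade is a new ★★ token».
Until now every SP9 slab row carried its region size only as a VALIDATED «inner-ball reading»; this file makes it a theorem.
OBJECTS (all BY NAME, nothing restated): ★ #45 «G2.b-SP9-SLAB» — `Bench.WSCC9SP9Slab.cert` on `WSCC9SP.relLurie D` (p504776), its
ε-level `cQ = 366951/655360000`, #94's upper fact `Bench.WSCC9SP9SlabRate.upper_posSemidef` (`p₂•1 − (P + Cᵀdiag(λb)C) ⪰ 0`,
`p₂ = p2Q = 4099/1024`, p535086) and slab sector hypothesis `Bench.WSCC9SP9SlabRate.hsec`; lineage O — `Bench.WSCC9SP9SlabO.certO`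
(p538073), `cOQ = 442223/41943040000`, `Bench.WSCC9SP9SlabORate.upperO_posSemidef` (`p₂ = p2OQ = 10703/1024`, p540398), `hsecO`.
CLASS THEOREM: lit-6's `SlabCertificate.ball_subset_well` (Literature/…/LuriePostnikovSlabInnerBall.lean).
NEW LITERALS: the two radii² `rhoQ := cQ/p2Q = 366951/2623360000` (radius ≈ 0.01183) and `rhoOQ := cOQ/p2OQ = 442223/438394880000`
(radius ≈ 0.00100), with the decided side conditions `p₂·ϱ ≤ c` and `(C_eᵀC_e)·ϱ < (97/200)²` on the 8 lines (`C_eᵀC_e ∈ {1, 2}`).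
WHAT IS PROVED: `sp9_ball_subset_well` — the Euclidean ball `{x : xᵀx ≤ rhoQ}` of the RELATIVE state (`Fin 8 ⊕ Fin 3`: 8 bus/machine
angles relative to bus 9 in rad, 3 machine speeds in rad/s — a mixed-unit norm, ref-3 W1) lies inside ★ #45's certified well
`{x ∈ slab(97/200) : V x ≤ cQ}`; `sp9_slab_roa_of_ball` — hence ★ #45's region sentence holds from EVERY phase point whose relative
state has `‖x‖² ≤ rhoQ` (no window or level hypothesis left to check); the same two theorems for lineage O (`sp9O_ball_subset_well`,
`sp9O_slab_roa_of_ball`, radius² `rhoOQ` — 139× smaller in ϱ: the rate-optimal certificate's well is certified only on a much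
smaller ball). THREE COLUMNS. CERTIFIED: the two inclusions and the two ball-form region sentences for MODEL M′_D
(`(WSCC9SP.params D).phaseField`), CLASS = the respective certified wells; inner estimate of an inner estimate — SUFFICIENT, NOT
SHARP. MODELLED: ★ #45 verbatim («MV-3 + lossless + MV-RD(0.046 @ slack G1) + D⟨declared: MV-SPD transplant machines, buses 1/10
synthetic⟩ + V-frozen(V1) + ω_R = 377 printed + ref bus 9»). VALIDATED: the producers' float radii (★ #45 json «inner_ball_deg_eps_level
0.50°» is a DIFFERENT, per-angle reading and stays VALIDATED). Nothing here says the WSCC system is stable.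
-/

noncomputable section

open Set Filter Topology Real Matrix
open Literature.MathematicalPhysics.PowerSystems
open Literature.MathematicalPhysics.PowerSystems.LyapunovFunctionFamily
open Summit.Ventures.GridStability.Models
open Summit.Ventures.GridStability.Models.StructurePreserving
open Summit.Ventures.GridStability.Models.WSCC9SP
open Summit.Ventures.GridStability.Lyapunov.WSCC9SP9Slab (cQ)
open Summit.Ventures.GridStability.Lyapunov.WSCC9SP9SlabRate (p2Q p2Q_facts)
open Summit.Ventures.GridStability.Lyapunov.WSCC9SP9SlabO (p2OQ cOQ scalarsO)
open Summit.Ventures.GridStability.Bench.WSCC9SP9Slab (D hD CQ C_eq cert sp9_slab_roa)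
open Summit.Ventures.GridStability.Bench.WSCC9SP9SlabRate (upper_posSemidef hsec)
open Summit.Ventures.GridStability.Bench.WSCC9SP9SlabO (certO sp9O_slab_roa)
open Summit.Ventures.GridStability.Bench.WSCC9SP9SlabORate (upperO_posSemidef hsecO)

namespace Summit.Ventures.GridStability.Bench.WSCC9SP9SlabBall

/-! ### The two radii and their decided side conditions -/

/-- Radius² of ★ #45's certified inner ball: `ϱ = cQ/p₂ = 366951/2623360000` (`√ϱ ≈ 0.01183`). -/
def rhoQ : ℚ := 366951/2623360000

/-- Radius² of the lineage-O certified inner ball: `ϱ_O = cOQ/p₂ = 442223/438394880000` (`√ϱ_O ≈ 0.00100`). -/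
def rhoOQ : ℚ := 442223/438394880000

/-- Side conditions of `ball_subset_well` for ★ #45, over `ℚ`: `p₂·ϱ ≤ c` and `(C_eᵀC_e)·ϱ < (97/200)²` on every line (kernel). -/
theorem rho_facts : p2Q * rhoQ ≤ cQ ∧ ∀ e : Fin 8, (CQ e ⬝ᵥ CQ e) * rhoQ < (97 / 200 : ℚ) ^ 2 := by
  constructor
  · norm_num [p2Q, rhoQ, cQ]
  · decide +kernel

/-- Side conditions for lineage O, over `ℚ` (kernel). -/
theorem rhoO_facts : p2OQ * rhoOQ ≤ cOQ ∧ ∀ e : Fin 8, (CQ e ⬝ᵥ CQ e) * rhoOQ < (97 / 200 : ℚ) ^ 2 := by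
  constructor
  · norm_num [p2OQ, rhoOQ, cOQ]
  · decide +kernel

/-- The channel norms of the relative object are the casts of `CQ e ⬝ CQ e` (plumbing via `C_eq`). -/
private theorem C_dot_eq (e : Fin 8) :
    (WSCC9SP.relLurie D).C e ⬝ᵥ (WSCC9SP.relLurie D).C e = ((CQ e ⬝ᵥ CQ e : ℚ) : ℝ) := by
  rw [C_eq]
  simp [dotProduct, Matrix.map_apply, Rat.cast_sum, Rat.cast_mul]

/-- `97/200 < 2·atan(1/4)` (the closed initial window lies inside the open slab). -/
private theorem gammaLo_lt : (((97 / 200 : ℚ)) : ℝ) < 2 * Real.arctan (((1 / 4 : ℚ)) : ℝ) :=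
  lt_two_arctan_of_sq_le (by norm_num) (by norm_num) (by norm_num)

/-! ### ★ #45: the certified inner ball -/

/-- ★ #45's sector hypothesis on the CLOSED window `97/200` (weakening of `hsec`, which holds on `2·atan(1/4)`). -/
theorem hsecLo : ∀ e ξ, |ξ - (WSCC9SP.relLurie D).δs e| ≤ (fun _ : Fin 8 => ((97 / 200 : ℚ) : ℝ)) e →
    cert.a e ≤ Real.cos ξ ∧ Real.cos ξ ≤ cert.b e :=
  fun e ξ h => hsec e ξ (h.trans gammaLo_lt.le)

/-- **«#45-BALL» — the CERTIFIED Euclidean inner ball of ★ #45's well**: `{x : xᵀx ≤ rhoQ} ⊆ {x ∈ slab(97/200) : V x ≤ cQ}` for the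
relative state of MODEL M′_D (lit-6 `ball_subset_well` with `t = p₂ = 4099/1024` from #94's upper fact). CERTIFIED; inner estimate of
an inner estimate. [cite: Khalil2002, Theorem 4.10; VuTuritsyn2017, §4.3 Theorem 1; Pai1981, §2.16 Theorem [18]] -/
theorem sp9_ball_subset_well :
    {x : Fin 8 ⊕ Fin 3 → ℝ | x ⬝ᵥ x ≤ ((rhoQ : ℚ) : ℝ)}
      ⊆ {x | x ∈ (WSCC9SP.relLurie D).slab (fun _ : Fin 8 => ((97 / 200 : ℚ) : ℝ)) ∧ cert.V x ≤ ((cQ : ℚ) : ℝ)} := by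
  refine cert.ball_subset_well (fun _ => by norm_num) (by exact_mod_cast p2Q_facts.1.le) upper_posSemidef hsecLo
    (by exact_mod_cast rho_facts.1) (fun e => ?_)
  rw [C_dot_eq]
  exact_mod_cast rho_facts.2 e

/-- **★ #45's region sentence FROM THE BALL**: for every phase point `y` of M′_D whose relative state `x = relState y` has
`xᵀx ≤ rhoQ = 366951/2623360000` (radius ≈ 0.01183 in the mixed rad / rad·s⁻¹ norm), a solution exists and EVERY solution keeps
`|σ_e(t) − σ*_e| < 2·atan(1/4)` and `V ≤ cQ` for all `t ≥ 0`, every bus-angle difference tends to the equilibrium's and every machine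
frequency deviation tends to `0` (= ★ #45's `sp9_slab_roa` with both hypotheses discharged by `sp9_ball_subset_well`). CERTIFIED for
MODEL M′_D; MODELLED = ★ #45 verbatim; nothing here says the WSCC system is stable.
[cite: Pai1981, §2.16 Theorem [18] and §4.6–§4.7; VuTuritsyn2017, §4.3 Theorem 1] -/
theorem sp9_slab_roa_of_ball {y : (Fin 9 → ℝ) × (Fin 9 → ℝ)}
    (hy : relState ref gnode δ₀ y ⬝ᵥ relState ref gnode δ₀ y ≤ ((rhoQ : ℚ) : ℝ)) :
    (∃ X : ℝ → (Fin 9 → ℝ) × (Fin 9 → ℝ), X 0 = y ∧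
        ∀ T : ℝ, ∀ t ∈ Icc 0 T, HasDerivWithinAt X ((WSCC9SP.params D).phaseField (X t)) (Icc 0 T) t) ∧
      ∀ X : ℝ → (Fin 9 → ℝ) × (Fin 9 → ℝ), X 0 = y →
        (∀ T : ℝ, ∀ t ∈ Icc 0 T, HasDerivWithinAt X ((WSCC9SP.params D).phaseField (X t)) (Icc 0 T) t) →
        (∀ t, 0 ≤ t →
            (∀ e, |((X t).1 (srcV e) - (X t).1 (tgtV e)) - (δ₀ (srcV e) - δ₀ (tgtV e))|
              < 2 * Real.arctan ((1 / 4 : ℚ) : ℝ)) ∧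
            cert.V (relState ref gnode δ₀ (X t)) ≤ ((cQ : ℚ) : ℝ)) ∧
          (∀ v w, Tendsto (fun t => (X t).1 v - (X t).1 w) atTop (𝓝 (δ₀ v - δ₀ w))) ∧
          ∀ v ∈ genS, Tendsto (fun t => (X t).2 v) atTop (𝓝 0) := by
  obtain ⟨hslab, hV⟩ := sp9_ball_subset_well hy
  have hdev := (Params.mem_slab_relState_iff (WSCC9SP.params D) ref gnode srcV tgtV wt δ₀ _ y).1 hslab
  exact sp9_slab_roa (fun e => (hdev e).le) hV

/-! ### Lineage O (rate-optimised): the certified inner ball -/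

/-- Lineage O's sector hypothesis on the closed window `97/200`. -/
theorem hsecOLo : ∀ e ξ, |ξ - (WSCC9SP.relLurie D).δs e| ≤ (fun _ : Fin 8 => ((97 / 200 : ℚ) : ℝ)) e →
    certO.a e ≤ Real.cos ξ ∧ Real.cos ξ ≤ certO.b e :=
  fun e ξ h => hsecO e ξ (h.trans gammaLo_lt.le)

/-- **«#94′-BALL» — the CERTIFIED Euclidean inner ball of the lineage-O well**: `{x : xᵀx ≤ rhoOQ} ⊆ {x ∈ slab(97/200) : V_O x ≤ cOQ}`
(`t = p₂ = 10703/1024`); 139× smaller in ϱ than ★ #45's — the rate-optimal certificate certifies its region on a much smaller ball.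
[cite: Khalil2002, Theorem 4.10; VuTuritsyn2017, §4.3 Theorem 1; Pai1981, §2.16 Theorem [18]] -/
theorem sp9O_ball_subset_well :
    {x : Fin 8 ⊕ Fin 3 → ℝ | x ⬝ᵥ x ≤ ((rhoOQ : ℚ) : ℝ)}
      ⊆ {x | x ∈ (WSCC9SP.relLurie D).slab (fun _ : Fin 8 => ((97 / 200 : ℚ) : ℝ)) ∧ certO.V x ≤ ((cOQ : ℚ) : ℝ)} := by
  refine certO.ball_subset_well (fun _ => by norm_num) (by exact_mod_cast scalarsO.2.2.2.1.le) upperO_posSemidef hsecOLo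
    (by exact_mod_cast rhoO_facts.1) (fun e => ?_)
  rw [C_dot_eq]
  exact_mod_cast rhoO_facts.2 e

/-- **Lineage O's region sentence FROM THE BALL** (`xᵀx ≤ rhoOQ` ⇒ the conclusions of `sp9O_slab_roa`). CERTIFIED for MODEL M′_D;
MODELLED = ★ #45 verbatim. [cite: Pai1981, §2.16 Theorem [18] and §4.6–§4.7; VuTuritsyn2017, §4.3 Theorem 1] -/
theorem sp9O_slab_roa_of_ball {y : (Fin 9 → ℝ) × (Fin 9 → ℝ)}
    (hy : relState ref gnode δ₀ y ⬝ᵥ relState ref gnode δ₀ y ≤ ((rhoOQ : ℚ) : ℝ)) :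
    (∃ X : ℝ → (Fin 9 → ℝ) × (Fin 9 → ℝ), X 0 = y ∧
        ∀ T : ℝ, ∀ t ∈ Icc 0 T, HasDerivWithinAt X ((WSCC9SP.params D).phaseField (X t)) (Icc 0 T) t) ∧
      ∀ X : ℝ → (Fin 9 → ℝ) × (Fin 9 → ℝ), X 0 = y →
        (∀ T : ℝ, ∀ t ∈ Icc 0 T, HasDerivWithinAt X ((WSCC9SP.params D).phaseField (X t)) (Icc 0 T) t) →
        (∀ t, 0 ≤ t →
            (∀ e, |((X t).1 (srcV e) - (X t).1 (tgtV e)) - (δ₀ (srcV e) - δ₀ (tgtV e))|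
              < 2 * Real.arctan ((1 / 4 : ℚ) : ℝ)) ∧
            certO.V (relState ref gnode δ₀ (X t)) ≤ ((cOQ : ℚ) : ℝ)) ∧
          (∀ v w, Tendsto (fun t => (X t).1 v - (X t).1 w) atTop (𝓝 (δ₀ v - δ₀ w))) ∧
          ∀ v ∈ genS, Tendsto (fun t => (X t).2 v) atTop (𝓝 0) := by
  obtain ⟨hslab, hV⟩ := sp9O_ball_subset_well hy
  have hdev := (Params.mem_slab_relState_iff (WSCC9SP.params D) ref gnode srcV tgtV wt δ₀ _ y).1 hslab
  exact sp9O_slab_roa (fun e => (hdev e).le) hV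

/-- The radii as exact quotients: `rhoQ = cQ/p2Q` and `rhoOQ = cOQ/p2OQ` (so `p₂ϱ = c` exactly in both lineages), and the ratio
`rhoQ/rhoOQ = 366951·438394880000/(2623360000·442223)` exceeds `138`. -/
theorem rho_eq : rhoQ = cQ / p2Q ∧ rhoOQ = cOQ / p2OQ ∧ 138 < rhoQ / rhoOQ := by
  refine ⟨?_, ?_, ?_⟩ <;> norm_num [rhoQ, rhoOQ, cQ, p2Q, cOQ, p2OQ]

end Summit.Ventures.GridStability.Bench.WSCC9SP9SlabBall

end
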